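import Summits.Ventures.PercRepro.RankLevelSetPlaneSix

/-!
# PercRepro — LINE-FREE `e`-free sets: planes have at most 5 points (p9, gen 27)

A set of the `e`-free core is LINE-FREE when every 3-point subset is independent (every line has exactly 2 points).
Then a set of rank `≤ 2` has `≤ 2` points, and the two sides of a cover of a point `x` of a set `F` of rank `≤ 3`
(`exists_two_sides_of_free`, rank `≤ 2` each) carry `≤ 2` points each: `|F| ≤ 1 + 2 + 2 = 5`.  Equivalently every
6-point subset of a line-free `e`-free set has rank `≥ 4` — the extra `JOB_LF6` of the line-free `(5, 15)` sub-census of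
proofs/P9-FLATBOUND-g25.md §7 (the premise of the `f(5)` certificate tree), here THEOREM-BACKED.

* **`ncard_le_two_of_eRk_le_two_of_lineFree`** — a rank-`≤ 2` subset of a line-free set has `≤ 2` points;
* **`ncard_le_five_of_eRk_le_three_of_lineFree`** — a rank-`≤ 3` subset of a line-free `e`-free set has `≤ 5` points;
* **`four_le_eRk_of_six_le_ncard_of_lineFree`** — `6` points of a line-free `e`-free set have rank `≥ 4`.
Axioms: standard.  Nothing here moves a window; NO window claim (p9 owns S4).
-/

open scoped Matroid

namespace PercRepro

namespace ThmN

open Set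

variable {α : Type}

/-- **Lines of a line-free set have 2 points**: if every 3-point subset of `M.E` is independent, a set of rank `≤ 2`
has at most 2 points. -/
theorem ncard_le_two_of_eRk_le_two_of_lineFree (M : Matroid α) [M.Finite]
    (hlf : ∀ T ⊆ M.E, T.ncard = 3 → M.Indep T) {S : Set α} (hS : S ⊆ M.E) (hr : M.eRk S ≤ 2) :
    S.ncard ≤ 2 := by
  by_contra h
  push Not at h
  have hSfin : S.Finite := M.ground_finite.subset hS
  have h3 : (3 : ℕ∞) ≤ S.encard := by
    rw [← hSfin.cast_ncard_eq]
    exact_mod_cast h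
  obtain ⟨T, hTS, hT⟩ := Set.exists_subset_encard_eq h3
  have hT3 : T.ncard = 3 := by
    rw [Set.ncard_def, hT]
    rfl
  have hTi : M.Indep T := hlf T (hTS.trans hS) hT3
  have hrT : M.eRk T = 3 := by rw [hTi.eRk_eq_encard, hT]
  have hle : M.eRk T ≤ M.eRk S := M.eRk_mono hTS
  rw [hrT] at hle
  have h32 : (3 : ℕ∞) ≤ 2 := hle.trans hr
  exact absurd h32 (by norm_num)

/-- **Planes of a line-free `e`-free set have at most 5 points**. -/
theorem ncard_le_five_of_eRk_le_three_of_lineFree (M : Matroid α) [M.Finite]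
    (hfree : ∀ e ∈ M.E, ∃ A ⊆ M.E \ {e}, e ∉ M.closure A ∧ e ∉ M.closure ((M.E \ {e}) \ A))
    (hlf : ∀ T ⊆ M.E, T.ncard = 3 → M.Indep T) {F : Set α} (hF : F ⊆ M.E) (hr : M.eRk F ≤ 3) :
    F.ncard ≤ 5 := by
  have hFfin : F.Finite := M.ground_finite.subset hF
  rcases F.eq_empty_or_nonempty with hFe | ⟨x, hx⟩
  · rw [hFe, Set.ncard_empty]; omega
  obtain ⟨S, T, hSF, hTF, hcov, -, hrS, hrT⟩ :=
    exists_two_sides_of_free M hfree hF (k := 2) (hr.trans (by norm_num)) hx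
  have hS2 : S.ncard ≤ 2 :=
    ncard_le_two_of_eRk_le_two_of_lineFree M hlf ((hSF.trans Set.sdiff_subset).trans hF) hrS
  have hT2 : T.ncard ≤ 2 :=
    ncard_le_two_of_eRk_le_two_of_lineFree M hlf ((hTF.trans Set.sdiff_subset).trans hF) hrT
  have hSfin : S.Finite := hFfin.subset (hSF.trans Set.sdiff_subset)
  have hTfin : T.Finite := hFfin.subset (hTF.trans Set.sdiff_subset)
  have hcard : (F \ {x}).ncard ≤ S.ncard + T.ncard :=
    (Set.ncard_le_ncard hcov (hSfin.union hTfin)).trans (Set.ncard_union_le S T)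
  have hFx : (F \ {x}).ncard + 1 = F.ncard := Set.ncard_sdiff_singleton_add_one hx hFfin
  omega

/-- **Six points of a line-free `e`-free set have rank `≥ 4`** (the extra `JOB_LF6`). -/
theorem four_le_eRk_of_six_le_ncard_of_lineFree (M : Matroid α) [M.Finite]
    (hfree : ∀ e ∈ M.E, ∃ A ⊆ M.E \ {e}, e ∉ M.closure A ∧ e ∉ M.closure ((M.E \ {e}) \ A))
    (hlf : ∀ T ⊆ M.E, T.ncard = 3 → M.Indep T) {F : Set α} (hF : F ⊆ M.E) (h6 : 6 ≤ F.ncard) :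
    (4 : ℕ∞) ≤ M.eRk F := by
  by_contra hlt
  push Not at hlt
  have hr : M.eRk F ≤ 3 := by
    have h : M.eRk F < (3 : ℕ∞) + 1 := by
      rw [show ((3 : ℕ∞) + 1) = 4 by norm_num]; exact hlt
    exact Order.le_of_lt_add_one h
  have := ncard_le_five_of_eRk_le_three_of_lineFree M hfree hlf hF hr
  omega

end ThmN

end PercRepro
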